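import Summits.RiemannHypothesis.RiemannHypothesis.Theorems.IntegerScrewCensusFastPair
import Literature.NumberTheory.LFunctions.ChainCheck

/-!
# Route `IntegerScrew` — fast kernel arithmetic for manifest-certificate checks (8): the error of the pair numerator

The ANALYTIC layer between the exact integer numerator `Num_ab` of the fast checker (`IntegerScrewCensusFastPair`) and
the real PSD part `P_ab = Σ_k ω_k (1 − cos t_k x_a − cos t_k x_b + cos t_k(x_a − x_b)) + w_J` of the manifest certificate:
* `atom_err` — per atom, if the stored values `ẑ_a, ẑ_b` are within `ε_a, ε_b` of unit complex numbers `z_a, z_b`, then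
  `|Re((1−ẑ_a)(1−ẑ_b^*)) − Re((1−z_a)(1−z_b^*))| ≤ 2ε_a + 2ε_b + ε_aε_b`;
* `depth_factor` — with `ε ≤ (2d−1)U`, `U ≤ 1/26`, `d ≤ 8`: `2ε_a + 2ε_b + ε_aε_b ≤ (4d_a + 4d_b + 5)·U`;
* `num_err` — `|Num_ab − 2^164·P_ab| ≤ (4d_a + 4d_b + 5)·2^104·Σ_k Ω_k U_k` for rows satisfying the row invariant of
  `IntegerScrewCensusFastRowsInv` (`RowOK`); `numD_err` for the diagonal;
* `errUnit_ge` — the checker's error unit dominates `2^104·Σ_k Ω_k U_k`;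
* `PR`/`PRd` — the real PSD part (off-diagonal / diagonal), `Num`/`NumD` vs `2^164·P`: `num_err`, `numD_err`.
RH-free; nothing here bears on the truth of RH.
-/

set_option linter.dupNamespace false
set_option autoImplicit false

namespace Summit.RiemannHypothesis.RiemannHypothesis.Theorems.IntegerScrew.Manifest.Fast

open Finset
open Literature.Analysis.ValidatedNumerics Literature.Analysis.ValidatedNumerics.Numerics
open Literature.Analysis.ValidatedNumerics.KroneckerDot

/-! ### Per-atom error -/

/-- `Re((1−u)(1−v^*)) = 1 − Re u − Re v + Re(u v^*)`. -/
theorem re_one_sub_mul (u v : ℂ) :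
    ((1 - u) * (starRingEnd ℂ) (1 - v)).re = 1 - u.re - v.re + (u * (starRingEnd ℂ) v).re := by
  simp [Complex.mul_re, Complex.sub_re, Complex.sub_im, Complex.conj_re, Complex.conj_im]
  ring

/-- `Re(u v^*) = Re u Re v + Im u Im v`. -/
theorem re_mul_conj (u v : ℂ) : (u * (starRingEnd ℂ) v).re = u.re * v.re + u.im * v.im := by
  simp [Complex.mul_re, Complex.conj_re, Complex.conj_im]

/-- **Per-atom error**: for `‖ẑa − za‖ ≤ εa`, `‖ẑb − zb‖ ≤ εb`, `‖za‖ = ‖zb‖ = 1`,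
`|Re((1−ẑa)(1−ẑb^*)) − Re((1−za)(1−zb^*))| ≤ 2εa + 2εb + εa·εb`. -/
theorem atom_err {za zb wa wb : ℂ} {εa εb : ℝ} (ha : ‖wa - za‖ ≤ εa) (hb : ‖wb - zb‖ ≤ εb) (hza : ‖za‖ = 1)
    (hzb : ‖zb‖ = 1) :
    |((1 - wa) * (starRingEnd ℂ) (1 - wb)).re - ((1 - za) * (starRingEnd ℂ) (1 - zb)).re| ≤
      2 * εa + 2 * εb + εa * εb := by
  have hεa : 0 ≤ εa := le_trans (norm_nonneg _) ha
  have hεb : 0 ≤ εb := le_trans (norm_nonneg _) hb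
  rw [re_one_sub_mul, re_one_sub_mul]
  have h1 : |wa.re - za.re| ≤ εa := le_trans (by simpa using Complex.abs_re_le_norm (wa - za)) ha
  have h2 : |wb.re - zb.re| ≤ εb := le_trans (by simpa using Complex.abs_re_le_norm (wb - zb)) hb
  have h3 : |(wa * (starRingEnd ℂ) wb).re - (za * (starRingEnd ℂ) zb).re| ≤ εa + εb + εa * εb := by
    have e : wa * (starRingEnd ℂ) wb - za * (starRingEnd ℂ) zb =
        (wa - za) * (starRingEnd ℂ) wb + za * (starRingEnd ℂ) (wb - zb) := by
      simp only [map_sub]; ring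
    have hn : ‖wa * (starRingEnd ℂ) wb - za * (starRingEnd ℂ) zb‖ ≤ εa * (1 + εb) + εb := by
      rw [e]
      refine (norm_add_le _ _).trans ?_
      rw [norm_mul, norm_mul, Complex.norm_conj, Complex.norm_conj, hza, one_mul]
      have hwb : ‖wb‖ ≤ 1 + εb := by
        have := norm_sub_norm_le wb zb; linarith
      nlinarith [norm_nonneg (wa - za), norm_nonneg wb]
    have hre := Complex.abs_re_le_norm (wa * (starRingEnd ℂ) wb - za * (starRingEnd ℂ) zb)
    rw [Complex.sub_re] at hre
    nlinarith
  have : 1 - wa.re - wb.re + (wa * (starRingEnd ℂ) wb).re - (1 - za.re - zb.re + (za * (starRingEnd ℂ) zb).re) =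
      -(wa.re - za.re) - (wb.re - zb.re) + ((wa * (starRingEnd ℂ) wb).re - (za * (starRingEnd ℂ) zb).re) := by ring
  rw [this]
  have t1 := abs_add_le (-(wa.re - za.re) - (wb.re - zb.re)) ((wa * (starRingEnd ℂ) wb).re - (za * (starRingEnd ℂ) zb).re)
  have t2 := abs_sub (-(wa.re - za.re)) (wb.re - zb.re)
  rw [abs_neg] at t2
  linarith

/-- **The depth factor**: `2εa + 2εb + εaεb ≤ (4da + 4db + 5)·U` for `ε ≤ (2d−1)U`, `1 ≤ d ≤ 8`, `0 ≤ U ≤ 1/26`. -/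
theorem depth_factor {εa εb U : ℝ} {da db : ℕ} (ha : εa ≤ (2 * da - 1 : ℝ) * U) (hb : εb ≤ (2 * db - 1 : ℝ) * U)
    (hεa : 0 ≤ εa) (hεb : 0 ≤ εb) (hU : 0 ≤ U) (hU' : U ≤ 1 / 26) (hda : da ≤ 8) (hdb : db ≤ 8) (hda1 : 1 ≤ da)
    (hdb1 : 1 ≤ db) :
    2 * εa + 2 * εb + εa * εb ≤ (4 * da + 4 * db + 5 : ℝ) * U := by
  have hda' : (da : ℝ) ≤ 8 := by exact_mod_cast hda
  have hdb' : (db : ℝ) ≤ 8 := by exact_mod_cast hdb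
  have hda1' : (1 : ℝ) ≤ da := by exact_mod_cast hda1
  have hdb1' : (1 : ℝ) ≤ db := by exact_mod_cast hdb1
  have h15a : εa ≤ 15 * U := le_trans ha (by nlinarith)
  have h15b : εb ≤ 15 * U := le_trans hb (by nlinarith)
  have hprod : εa * εb ≤ 15 * U * (15 * U) := mul_le_mul h15a h15b hεb (by linarith)
  nlinarith

/-! ### The error unit -/

/-- **The checker's error unit dominates `2^104 Σ_k Ω_k U_k`** (`U_k = Uk Wmax 500 j_k`). -/
theorem errUnit_ge (Wmax : ℕ) (js oms : List ℕ) (hlen : js.length = oms.length) :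
    2 ^ 104 * ∑ k ∈ range js.length, (oms.getD k 0 : ℝ) * Uk Wmax 500 (js.getD k 0) ≤ (errUnit Wmax js oms : ℝ) := by
  set A := SCL * sumN (List.zipWith (fun j o => o * (32 * j * Wmax + 7000)) js oms) with hA
  have e : errUnit Wmax js oms = A / 500 + 1 := rfl
  rw [e]
  have hq := (Literature.NumberTheory.LFunctions.ChainCheck.natDiv_real_bounds A (b := 500) (by norm_num)).2
  have hsum : (A : ℝ) = SCL * ∑ k ∈ range js.length, (oms.getD k 0 : ℝ) * (32 * (js.getD k 0 : ℝ) * Wmax + 7000) := by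
    rw [hA, sumN_zipWith _ js oms hlen]
    push_cast
    rfl
  have hS : (SCL : ℝ) = 2 ^ 52 := by norm_num [SCL]
  have hmain : 2 ^ 104 * ∑ k ∈ range js.length, (oms.getD k 0 : ℝ) * Uk Wmax 500 (js.getD k 0) = (A : ℝ) / 500 := by
    rw [hsum, hS, Finset.mul_sum, Finset.mul_sum, Finset.sum_div]
    refine Finset.sum_congr rfl fun k _ => ?_
    unfold Uk
    rw [hS]
    push_cast
    ring
  rw [hmain]
  push_cast
  linarith

/-! ### The numerator error -/

/-- The real PSD part `P(x_a, x_b) = Σ_k ω_k (1 − cos t_k x_a − cos t_k x_b + cos t_k x_a cos t_k x_b + sin t_k x_a sin t_k x_b) + w_J`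
of the certificate (`t_k = j_k/500`, `ω_k = Ω_k/2^60`, `w_J = WJ/2^60`). -/
noncomputable def PR (js oms : List ℕ) (WJ K : ℕ) (xa xb : ℝ) : ℝ :=
  ∑ k ∈ range K, ((oms.getD k 0 : ℝ) / 2 ^ 60) *
      (1 - Real.cos ((js.getD k 0 : ℝ) / 500 * xa) - Real.cos ((js.getD k 0 : ℝ) / 500 * xb)
        + (Real.cos ((js.getD k 0 : ℝ) / 500 * xa) * Real.cos ((js.getD k 0 : ℝ) / 500 * xb)
          + Real.sin ((js.getD k 0 : ℝ) / 500 * xa) * Real.sin ((js.getD k 0 : ℝ) / 500 * xb))) +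
    (WJ : ℝ) / 2 ^ 60

/-- The stored complex value of atom `k` in a row. -/
noncomputable def zhat (r : List (ℕ × ℕ)) (k : ℕ) : ℂ := zOf (r.getD k (0, 0)).1 (r.getD k (0, 0)).2

/-- The true unit complex value `e^{i t_k x}` of atom `k` at logarithm `x`. -/
noncomputable def ztrue (js : List ℕ) (k : ℕ) (x : ℝ) : ℂ :=
  Complex.exp ((((js.getD k 0 : ℝ) / 500 * x : ℝ) : ℂ) * Complex.I)

/-- The summand of `Num` at atom `k` is `2^104 Ω_k · Re((1−ẑ_a)(1−ẑ_b^*))`. -/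
theorem num_term (oms : List ℕ) (ra rb : List (ℕ × ℕ)) (k : ℕ) :
    (2 : ℝ) ^ 104 * (omv oms k : ℝ) - 2 ^ 52 * ((omv oms k : ℝ) * (xv ra k : ℝ) + (omv oms k : ℝ) * (xv rb k : ℝ)) +
        (omv oms k : ℝ) * ((xv ra k : ℝ) * (xv rb k : ℝ) + (yv ra k : ℝ) * (yv rb k : ℝ)) =
      2 ^ 104 * (omv oms k : ℝ) * ((1 - zhat ra k) * (starRingEnd ℂ) (1 - zhat rb k)).re := by
  rw [re_one_sub_mul, re_mul_conj]
  have hS : (SCL : ℝ) = 2 ^ 52 := by norm_num [SCL]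
  simp only [zhat, zOf, xv, yv, hS]
  ring

/-- The summand of `2^164·P` at atom `k` is `2^104 Ω_k · Re((1−z_a)(1−z_b^*))`. -/
theorem pr_term (js oms : List ℕ) (k : ℕ) (xa xb : ℝ) :
    (2 : ℝ) ^ 164 * (((oms.getD k 0 : ℝ) / 2 ^ 60) *
      (1 - Real.cos ((js.getD k 0 : ℝ) / 500 * xa) - Real.cos ((js.getD k 0 : ℝ) / 500 * xb)
        + (Real.cos ((js.getD k 0 : ℝ) / 500 * xa) * Real.cos ((js.getD k 0 : ℝ) / 500 * xb)
          + Real.sin ((js.getD k 0 : ℝ) / 500 * xa) * Real.sin ((js.getD k 0 : ℝ) / 500 * xb)))) =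
      2 ^ 104 * (omv oms k : ℝ) * ((1 - ztrue js k xa) * (starRingEnd ℂ) (1 - ztrue js k xb)).re := by
  rw [re_one_sub_mul, re_mul_conj]
  simp only [ztrue, exp_mul_I_eq, omv, Int.cast_natCast]
  ring

/-- `Num_K − 2^164 P_K = Σ_{k<K} 2^104 Ω_k (Re((1−ẑa)(1−ẑb^*)) − Re((1−za)(1−zb^*)))`. -/
theorem num_sub_pr (js oms : List ℕ) (ra rb : List (ℕ × ℕ)) (WJ : ℕ) (xa xb : ℝ) : ∀ K : ℕ,
    (Num oms ra rb K WJ : ℝ) - 2 ^ 164 * PR js oms WJ K xa xb =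
      ∑ k ∈ range K, 2 ^ 104 * (omv oms k : ℝ) *
        (((1 - zhat ra k) * (starRingEnd ℂ) (1 - zhat rb k)).re -
          ((1 - ztrue js k xa) * (starRingEnd ℂ) (1 - ztrue js k xb)).re)
  | 0 => by simp [Num, So, Lc, Ecs, PR]; ring
  | K + 1 => by
    have ih := num_sub_pr js oms ra rb WJ xa xb K
    have t1 := num_term oms ra rb K
    have t2 := pr_term js oms K xa xb
    simp only [Num, So, Lc, Ecs, PR, Finset.sum_range_succ] at ih ⊢
    push_cast at ih ⊢
    linear_combination ih + t1 - t2

/-- **The numerator error**: `|Num_ab − 2^164 P_ab| ≤ (4d_a + 4d_b + 5)·2^104·Σ_k Ω_k U_k`. -/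
theorem num_err {js oms : List ℕ} {ra rb : List (ℕ × ℕ)} {K WJ Wmax da db : ℕ} {xa xb : ℝ}
    (hea : ∀ k, k < K → ‖zhat ra k - ztrue js k xa‖ ≤ (2 * da - 1 : ℝ) * Uk Wmax 500 (js.getD k 0))
    (heb : ∀ k, k < K → ‖zhat rb k - ztrue js k xb‖ ≤ (2 * db - 1 : ℝ) * Uk Wmax 500 (js.getD k 0))
    (hU : ∀ k, k < K → Uk Wmax 500 (js.getD k 0) ≤ 1 / 26) (hda : da ≤ 8) (hdb : db ≤ 8) (hda1 : 1 ≤ da)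
    (hdb1 : 1 ≤ db) :
    |(Num oms ra rb K WJ : ℝ) - 2 ^ 164 * PR js oms WJ K xa xb| ≤
      (4 * da + 4 * db + 5 : ℝ) * (2 ^ 104 * ∑ k ∈ range K, (oms.getD k 0 : ℝ) * Uk Wmax 500 (js.getD k 0)) := by
  rw [num_sub_pr]
  refine (Finset.abs_sum_le_sum_abs _ _).trans ?_
  rw [Finset.mul_sum, Finset.mul_sum]
  refine Finset.sum_le_sum fun k hk => ?_
  rw [Finset.mem_range] at hk
  have hUk : 0 ≤ Uk Wmax 500 (js.getD k 0) := by unfold Uk; positivity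
  have hat := atom_err (le_refl ‖zhat ra k - ztrue js k xa‖) (le_refl ‖zhat rb k - ztrue js k xb‖)
    (by unfold ztrue; exact norm_exp_real_mul_I _) (by unfold ztrue; exact norm_exp_real_mul_I _)
  have hdf := depth_factor (hea k hk) (heb k hk) (norm_nonneg _) (norm_nonneg _) hUk (hU k hk) hda hdb hda1 hdb1
  have hΩ' : (omv oms k : ℝ) = (oms.getD k 0 : ℝ) := by unfold omv; push_cast; rfl
  rw [abs_mul, hΩ', abs_of_nonneg (by positivity : (0 : ℝ) ≤ 2 ^ 104 * (oms.getD k 0 : ℝ))]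
  calc 2 ^ 104 * (oms.getD k 0 : ℝ) * |((1 - zhat ra k) * (starRingEnd ℂ) (1 - zhat rb k)).re -
          ((1 - ztrue js k xa) * (starRingEnd ℂ) (1 - ztrue js k xb)).re|
      ≤ 2 ^ 104 * (oms.getD k 0 : ℝ) * ((4 * da + 4 * db + 5 : ℝ) * Uk Wmax 500 (js.getD k 0)) :=
        mul_le_mul_of_nonneg_left (hat.trans hdf) (by positivity)
    _ = (4 * da + 4 * db + 5 : ℝ) * (2 ^ 104 * ((oms.getD k 0 : ℝ) * Uk Wmax 500 (js.getD k 0))) := by ring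

/-! ### The diagonal numerator error -/

/-- The real diagonal PSD part `P(x_a, x_a) = Σ_k ω_k (2 − 2 cos t_k x_a) + w_J`. -/
noncomputable def PRd (js oms : List ℕ) (WJ K : ℕ) (xa : ℝ) : ℝ :=
  ∑ k ∈ range K, ((oms.getD k 0 : ℝ) / 2 ^ 60) * (2 - 2 * Real.cos ((js.getD k 0 : ℝ) / 500 * xa)) + (WJ : ℝ) / 2 ^ 60

/-- The exact diagonal numerator `NumD_a = 2^104(2ΣΩ + WJ) − 2^53 L_a` of `2^164·P̂_aa`. -/
def NumD (oms : List ℕ) (ra : List (ℕ × ℕ)) (K WJ : ℕ) : ℤ := 2 ^ 104 * (2 * So oms K + WJ) - 2 ^ 53 * Lc oms ra K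

/-- `NumD_K − 2^164 Pd_K = Σ_{k<K} 2^105 Ω_k (Re z_a − Re ẑ_a)`. -/
theorem numD_sub_prd (js oms : List ℕ) (ra : List (ℕ × ℕ)) (WJ : ℕ) (xa : ℝ) : ∀ K : ℕ,
    (NumD oms ra K WJ : ℝ) - 2 ^ 164 * PRd js oms WJ K xa =
      ∑ k ∈ range K, 2 ^ 105 * (omv oms k : ℝ) * ((ztrue js k xa).re - (zhat ra k).re)
  | 0 => by simp [NumD, So, Lc, PRd]; ring
  | K + 1 => by
    have ih := numD_sub_prd js oms ra WJ xa K
    have hS : (SCL : ℝ) = 2 ^ 52 := by norm_num [SCL]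
    simp only [NumD, So, Lc, PRd, Finset.sum_range_succ] at ih ⊢
    push_cast at ih ⊢
    simp only [ztrue, zhat, zOf, exp_mul_I_eq, omv, xv, Int.cast_natCast, hS] at ih ⊢
    linear_combination ih

/-- **The diagonal numerator error**: `|NumD_a − 2^164 P_aa| ≤ (4d_a − 2)·2^104·Σ_k Ω_k U_k`. -/
theorem numD_err {js oms : List ℕ} {ra : List (ℕ × ℕ)} {K WJ Wmax da : ℕ} {xa : ℝ}
    (hea : ∀ k, k < K → ‖zhat ra k - ztrue js k xa‖ ≤ (2 * da - 1 : ℝ) * Uk Wmax 500 (js.getD k 0)) :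
    |(NumD oms ra K WJ : ℝ) - 2 ^ 164 * PRd js oms WJ K xa| ≤
      (4 * da - 2 : ℝ) * (2 ^ 104 * ∑ k ∈ range K, (oms.getD k 0 : ℝ) * Uk Wmax 500 (js.getD k 0)) := by
  rw [numD_sub_prd]
  refine (Finset.abs_sum_le_sum_abs _ _).trans ?_
  rw [Finset.mul_sum, Finset.mul_sum]
  refine Finset.sum_le_sum fun k hk => ?_
  rw [Finset.mem_range] at hk
  have hre : |(ztrue js k xa).re - (zhat ra k).re| ≤ (2 * da - 1 : ℝ) * Uk Wmax 500 (js.getD k 0) := by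
    have h := Complex.abs_re_le_norm (zhat ra k - ztrue js k xa)
    rw [Complex.sub_re] at h
    rw [abs_sub_comm]
    exact h.trans (hea k hk)
  have hΩ' : (omv oms k : ℝ) = (oms.getD k 0 : ℝ) := by unfold omv; push_cast; rfl
  rw [abs_mul, hΩ', abs_of_nonneg (by positivity : (0 : ℝ) ≤ 2 ^ 105 * (oms.getD k 0 : ℝ))]
  calc 2 ^ 105 * (oms.getD k 0 : ℝ) * |(ztrue js k xa).re - (zhat ra k).re|
      ≤ 2 ^ 105 * (oms.getD k 0 : ℝ) * ((2 * da - 1 : ℝ) * Uk Wmax 500 (js.getD k 0)) :=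
        mul_le_mul_of_nonneg_left hre (by positivity)
    _ = (4 * da - 2 : ℝ) * (2 ^ 104 * ((oms.getD k 0 : ℝ) * Uk Wmax 500 (js.getD k 0))) := by ring

end Summit.RiemannHypothesis.RiemannHypothesis.Theorems.IntegerScrew.Manifest.Fast
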